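import Summits.CriticalPhenomena.PercolationContinuityZ3.Theorems.Transplant.FreeSubmonoidExpGrowth
import Mathlib.GroupTheory.FreeGroup.Reduce
import HarnessLib

/-!
# `θ(p_c) = 0` on EVERY Cayley graph of EVERY free group of rank ≥ 2 — a concrete kernel customer of the exponential-growth row (unconditional)

builds on p205010 (kernel theorem, internal audit signed; external expert review pending) — nothing in this file uses p205010; unconditional, no node.
Lane `prim-bschramm`, seat `prim-bschramm-p4` gen 22 (PART C3 of `P4-GENERAL.md` §44).  Helper file (`--supports stmt-CriticalPhenomena-4575 --as helper`).

THE POINT.  First concrete group entered in the exponential-growth row of the C3 class map by the free-pair certificate (`FreePair.criticalContinuity`,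
gen 22): in Mathlib's `FreeGroup α`, two distinct letters `a ≠ b` generate a free submonoid — positive words are reduced (`FreeGroup.IsReduced`), so
`FreeGroup.toWord ∘ FreeGroup.mk` is the identity on them — hence **`FreeGrp.criticalContinuity_anyGens`: for every finite generating set `S` of
`FreeGroup α` (`α ∋ a ≠ b`) and every vertex `g`, `θ_g(p_c(Cay(FreeGroup α; S))) = 0`**, unconditionally (exponential growth for every `S`,
`FreeGrp.hasExponentialGrowth_anyGens`, + Hutchcroft 2016 Thm. 1 PROVED in the tree); `p_c < 1` there is `ExpGrowth.criticalProb_lt_one_of_hasExponentialGrowth`.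
[cite: LyonsPeres2016, §7.4 Thm. 7.20 (exponential growth), §7.9] [cite: Hutchcroft2016, Thm. 1] [cite: BenjaminiSchramm1996, Conj. 4; §2 (Cayley graphs)]
-/

noncomputable section

namespace Summit.CriticalPhenomena.PercolationContinuityZ3.Theorems.Transplant
open SimpleGraph Literature.Probability.LatticeModels Literature.Probability.Percolation
open scoped Classical

namespace FreeGrp

variable {α : Type}

/-- The letters of the positive word coded by `w`. [folklore] -/
theorem isReduced_posWord (a b : α) : ∀ w : List Bool, FreeGroup.IsReduced (w.map fun bit => ((if bit then a else b), true))
  | [] => List.IsChain.nil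
  | [_] => List.IsChain.singleton _
  | _ :: y :: w => List.IsChain.cons_cons (fun _ => rfl) (isReduced_posWord a b (y :: w))

/-- The positive word in `of a`, `of b` coded by `w` is `mk` of its letters. [folklore] -/
theorem prod_posWord_eq_mk (a b : α) : ∀ w : List Bool,
    (w.map fun bit => if bit then FreeGroup.of a else FreeGroup.of b).prod = FreeGroup.mk (w.map fun bit => ((if bit then a else b), true))
  | [] => by rw [List.map_nil, List.prod_nil, List.map_nil, FreeGroup.one_eq_mk]
  | x :: w => by
    rw [List.map_cons, List.prod_cons, List.map_cons, prod_posWord_eq_mk a b w]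
    have hx : (if x then FreeGroup.of a else FreeGroup.of b) = FreeGroup.mk [((if x then a else b), true)] := by
      cases x <;> rfl
    rw [hx, FreeGroup.mul_mk, List.singleton_append]

/-- **Two distinct letters generate a free submonoid of the free group**: positive words in `of a`, `of b` are pairwise distinct. [folklore] -/
theorem posWord_injective [DecidableEq α] {a b : α} (hab : a ≠ b) :
    Function.Injective fun w : List Bool => (w.map fun bit => if bit then FreeGroup.of a else FreeGroup.of b).prod := by
  intro w w' h
  have h1 : FreeGroup.mk (w.map fun bit => ((if bit then a else b), true)) = FreeGroup.mk (w'.map fun bit => ((if bit then a else b), true)) := by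
    have h' : (w.map fun bit => if bit then FreeGroup.of a else FreeGroup.of b).prod =
        (w'.map fun bit => if bit then FreeGroup.of a else FreeGroup.of b).prod := h
    rwa [prod_posWord_eq_mk, prod_posWord_eq_mk] at h'
  have h2 := congrArg FreeGroup.toWord h1
  rw [FreeGroup.toWord_mk, FreeGroup.toWord_mk, (isReduced_posWord a b w).reduce_eq, (isReduced_posWord a b w').reduce_eq] at h2
  have hf : Function.Injective fun bit : Bool => ((if bit then a else b), true) := by
    intro x y hxy
    have h3 := congrArg Prod.fst hxy
    cases x <;> cases y <;> simp_all [eq_comm]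
  exact (List.map_injective_iff.2 hf) h2

/-- **Every Cayley graph of a free group of rank ≥ 2 has exponential growth.** [cite: LyonsPeres2016, §7.4 Thm. 7.20] -/
theorem hasExponentialGrowth_anyGens [DecidableEq α] {a b : α} (hab : a ≠ b) (S : Finset (FreeGroup α)) (hS : Subgroup.closure (S : Set (FreeGroup α)) = ⊤) :
    Literature.Barriers.CriticalPhenomena.HasExponentialGrowth (mulCayley (↑S : Set (FreeGroup α))) :=
  FreePair.hasExponentialGrowth S hS (posWord_injective hab)

/-- **THEOREM (unconditional, kernel): `θ_g(p_c) = 0` on every Cayley graph of every free group on at least two letters** — every finite generating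
set, every vertex. [cite: Hutchcroft2016, Thm. 1] [cite: BenjaminiSchramm1996, Conj. 4; §2 (Cayley graphs)] -/
theorem criticalContinuity_anyGens [DecidableEq α] {a b : α} (hab : a ≠ b) (S : Finset (FreeGroup α)) (hS : Subgroup.closure (S : Set (FreeGroup α)) = ⊤)
    (g : FreeGroup α) : theta (mulCayley (↑S : Set (FreeGroup α))) g (criticalProbIOf (mulCayley (↑S : Set (FreeGroup α))) g) = 0 :=
  FreePair.criticalContinuity S hS (posWord_injective hab) g

end FreeGrp

end Summit.CriticalPhenomena.PercolationContinuityZ3.Theorems.Transplant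
end
-- build-touch 2026-08-25T07:52:15Z T1-B (lead g18): re-land of p391409, declarations byte-identical
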